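import Summits.ABC.ABC.Theorems.IsogenyGlueCongruenceEllipticGluingPrimeBoundStubBigImageTorsionCore
import Literature.AlgebraicGeometry.Motives.FaltingsAbelian
import Literature.AlgebraicGeometry.Motives.AbelianVarietyImageSimpleProofs
import Literature.NumberTheory.EllipticCurves.TateModuleProjSurjectiveProofs
import HarnessLib

/-!
# CM torsion core, helpers 8/8: the Faltings step

Helper file (8/8) for stub `stub_CMTorsionCoreOf` ((K†), the CM torsion core) of line
`Sketch` (isotypic–Minkowski reduction) of crux U
`Summit.ABC.ABC.Theses.IsogenyGlueCongruence.EllipticGluingPrimeBound` (stmt-ABC-13919); the stub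
itself is proved in `…EllipticGluingPrimeBoundStubCMTorsionCoreOf`.

* `false_of_eigenvector` (registered sub-goal) — for `E` (dimension `1`) and `A` over `ℚ` with `A`
  geometrically `E`-isotypic and `Hom_ℚ(E, A) = 0`: no non-zero `f ∈ Hom(E_ℚ̄, A_ℚ̄)` transforms
  under the corner Galois action by a quadratic character `χ` for which `E(ℚ̄)` carries a
  `χ`-semi-equivariant additive `ψ_E` with `ψ_E² = D' ≠ 0`. The composite `ev_f ∘ ψ_E` is
  `Γ_ℚ`-equivariant on points, its Tate-module map vanishes by FALTINGS' theorem
  (`Literature.AlgebraicGeometry.Motives.faltings_tate_bijective E A p`, a hypothesis), so `ev_f`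
  kills `E[p^∞]`; while isotypy (`nsmul_id_mem_closure`), simplicity of `E_ℚ̄` and the corner
  calculus of the big-image helpers (`corner_ev_smul`, `act_comp`, `act_baseChange`) make `[n]`
  kill `E[p^k]` for all `k` — absurd.

This is the only place where Faltings' theorem enters the CM torsion core. No `def`, no named
fact.
-/

noncomputable section

-- `Summit.<Summit>.<Problem>` is the mandated summit-side namespace (CONVENTIONS §2); for the
-- single-conjunct summit `ABC` the two coincide, so the duplicate `ABC.ABC` is deliberate.
set_option linter.dupNamespace false

namespace Summit.ABC.ABC.Theorems.IsotypicMinkowski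

open scoped AddSubgroup Matrix

open CategoryTheory CategoryTheory.Limits AlgebraicGeometry
open Literature.AlgebraicGeometry.Motives
open Summit.ABC.ABC.Theses.IsogenyGlueCongruence

/-! ## The Faltings step (registered sub-goal of the stub) -/


/-- **The Faltings step: no `χ`-eigenvector in `Hom(E_ℚ̄, A_ℚ̄)`.** Let `E` (dimension `1`) and
`A` be abelian varieties over `ℚ` with `A` geometrically `E`-isotypic and `Hom_ℚ(E, A) = 0`, let
`f ∈ Hom(E_ℚ̄, A_ℚ̄)` transform under the corner Galois action by a quadratic character `χ`, and let
`ψ_E` be an additive endomorphism of `E(ℚ̄)` with `ψ_E² = D' ≠ 0` and `ψ_E(σ y) = χ(σ) σ ψ_E(y)`.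
Then `f = 0`: `F = ev_f ∘ ψ_E : E(ℚ̄) → A(ℚ̄)` is `Γ_ℚ`-equivariant (`corner_ev_smul`), so `T_p F`
is an intertwining map of Tate modules and vanishes by Faltings (`faltings_tate_bijective E A p`,
the source `ℤ_p ⊗ Hom_ℚ(E, A)` being zero); with `p ∤ D'` and `[p]` onto `E(ℚ̄)`, `ev_f` kills
`E[p^∞]`; but `f ≠ 0` composes with some projection `A_ℚ̄ → E_ℚ̄` to an isogeny `g` of `E_ℚ̄`
(isotypy, `nsmul_id_mem_closure`; simplicity of `E_ℚ̄`), `g ≫ g' = [n]`, and the corner calculus on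
`(E ⊞ A)(ℚ̄)` shows `[n]` kills `E[p^k]` for all `k`, contradicting `#E[p^n] = p^{2n} > n²`.
[folklore] -/
theorem false_of_eigenvector
    (hFal : ∀ (A B : AbelianVariety.{0} ℚ) (ℓ : ℕ) [Fact ℓ.Prime],
      Literature.AlgebraicGeometry.Motives.faltings_tate_bijective A B ℓ)
    (E A : AbelianVariety.{0} ℚ) (hE1 : E.dim = 1)
    (hiso : ∀ (C : AbelianVariety.{0} (AlgebraicClosure ℚ))
        (g : A.baseChange (AlgebraicClosure ℚ) ⟶ C),
        Surjective (AbelianVariety.Hom.toSchemeHom g) → C.dim ≠ 0 →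
        ∃ f : E.baseChange (AlgebraicClosure ℚ) ⟶ C, f ≠ 0)
    (hfree : ∀ f : E ⟶ A, f = 0)
    (ρ : Representation ℤ (Field.absoluteGaloisGroup ℚ)
        (E.baseChange (AlgebraicClosure ℚ) ⟶ A.baseChange (AlgebraicClosure ℚ)))
    (hρ : ∀ (σ : Field.absoluteGaloisGroup ℚ)
        (f : E.baseChange (AlgebraicClosure ℚ) ⟶ A.baseChange (AlgebraicClosure ℚ)),
        ρ σ f = AbelianVariety.Hom.baseChange (AlgebraicClosure ℚ) (biprod.inl : E ⟶ E ⊞ A) ≫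
          (E ⊞ A).galConj (AlgebraicClosure ℚ) (Field.absoluteGaloisGroup.toAlgEquiv ℚ σ)
            (AbelianVariety.Hom.baseChange (AlgebraicClosure ℚ) (biprod.fst : E ⊞ A ⟶ E) ≫ f ≫
              AbelianVariety.Hom.baseChange (AlgebraicClosure ℚ) (biprod.inr : A ⟶ E ⊞ A)) ≫
          AbelianVariety.Hom.baseChange (AlgebraicClosure ℚ) (biprod.snd : E ⊞ A ⟶ A))
    (χ : Field.absoluteGaloisGroup ℚ →* ℤˣ)
    (f : E.baseChange (AlgebraicClosure ℚ) ⟶ A.baseChange (AlgebraicClosure ℚ))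
    (hf : ∀ σ, ρ σ f = ((χ σ : ℤˣ) : ℤ) • f) (hf0 : f ≠ 0)
    (ψE : E.geomPoints →+ E.geomPoints) (D' : ℤ) (hD' : D' ≠ 0)
    (hψψ : ∀ y, ψE (ψE y) = D' • y)
    (hψσ : ∀ (σ : Field.absoluteGaloisGroup ℚ) (y : E.geomPoints),
      ψE (σ • y) = ((χ σ : ℤˣ) : ℤ) • σ • ψE y) : False := by
  classical
  -- the corner evaluation, additive in `f`
  let ev : (E.baseChange (AlgebraicClosure ℚ) ⟶ A.baseChange (AlgebraicClosure ℚ)) →+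
      E.geomPoints →+ A.geomPoints :=
    AddMonoidHom.mk' (fun f ↦ AddMonoidHom.mk' (fun y ↦
      AbelianVariety.Hom.geomPointsMap (biprod.snd : E ⊞ A ⟶ A)
        ((((AddMonoidHom.id (E ⊞ A).geomPoints).comp (MonoidHom.toAdditive ((E ⊞ A).pointsEnd
          (AlgebraicClosure ℚ)
          (AbelianVariety.Hom.baseChange (AlgebraicClosure ℚ) (biprod.fst : E ⊞ A ⟶ E) ≫ f ≫
            AbelianVariety.Hom.baseChange (AlgebraicClosure ℚ) (biprod.inr : A ⟶ E ⊞ A))))).comp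
          (AddMonoidHom.id (E ⊞ A).geomPoints))
          (AbelianVariety.Hom.geomPointsMap (biprod.inl : E ⟶ E ⊞ A) y)))
      (fun y y' ↦ by rw [map_add, map_add, map_add])) (fun f g ↦ by
      ext y
      simp only [AddMonoidHom.add_apply, AddMonoidHom.mk'_apply]
      rw [Preadditive.add_comp, Preadditive.comp_add,
        ← map_add (AbelianVariety.Hom.geomPointsMap (biprod.snd : E ⊞ A ⟶ A))]
      congr 1
      exact BigImage.act_add (E ⊞ A) _ _ _)
  have hev_apply : ∀ (g : E.baseChange (AlgebraicClosure ℚ) ⟶ A.baseChange (AlgebraicClosure ℚ))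
      (y : E.geomPoints), ev g y = AbelianVariety.Hom.geomPointsMap (biprod.snd : E ⊞ A ⟶ A)
        ((((AddMonoidHom.id (E ⊞ A).geomPoints).comp (MonoidHom.toAdditive ((E ⊞ A).pointsEnd
          (AlgebraicClosure ℚ)
          (AbelianVariety.Hom.baseChange (AlgebraicClosure ℚ) (biprod.fst : E ⊞ A ⟶ E) ≫ g ≫
            AbelianVariety.Hom.baseChange (AlgebraicClosure ℚ) (biprod.inr : A ⟶ E ⊞ A))))).comp
          (AddMonoidHom.id (E ⊞ A).geomPoints))
          (AbelianVariety.Hom.geomPointsMap (biprod.inl : E ⟶ E ⊞ A) y)) := fun _ _ ↦ rfl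
  have hev : ∀ (σ : Field.absoluteGaloisGroup ℚ) (g) (y : E.geomPoints),
      ev (ρ σ g) (σ • y) = σ • ev g y := fun σ g y ↦ by
    rw [hev_apply, hev_apply, hρ σ g]
    exact BigImage.corner_ev_smul E A σ g y
  have hχχ : ∀ σ, ((χ σ : ℤˣ) : ℤ) * ((χ σ : ℤˣ) : ℤ) = 1 := fun σ ↦ by
    rw [← Units.val_mul, Int.units_mul_self, Units.val_one]
  have hevσ : ∀ (σ : Field.absoluteGaloisGroup ℚ) (y : E.geomPoints),
      ev f (σ • y) = ((χ σ : ℤˣ) : ℤ) • σ • ev f y := fun σ y ↦ by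
    have h := hev σ f y
    rw [hf σ, map_zsmul, AddMonoidHom.zsmul_apply] at h
    rw [← h, smul_smul, hχχ, one_smul]
  -- `F = ev f ∘ ψE` is `Γ_ℚ`-equivariant
  set F : E.geomPoints →+ A.geomPoints := (ev f).comp ψE with hF_def
  have hF : ∀ y, F y = ev f (ψE y) := fun y ↦ rfl
  have hFσ : ∀ (σ : Field.absoluteGaloisGroup ℚ) (y : E.geomPoints), F (σ • y) = σ • F y :=
    fun σ y ↦ by
      rw [hF, hF, hψσ, map_zsmul, hevσ, smul_smul, hχχ, one_smul]
  -- a prime `p ∤ D'`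
  obtain ⟨p, hpD, hp⟩ := Nat.exists_infinite_primes (D'.natAbs + 1)
  haveI : Fact p.Prime := ⟨hp⟩
  have hpD' : ¬ (p : ℤ) ∣ D' := fun h ↦ by
    have h1 : p ∣ D'.natAbs := Int.natCast_dvd.1 h
    have h2 : D'.natAbs ≠ 0 := Int.natAbs_ne_zero.2 hD'
    exact absurd (Nat.le_of_dvd (Nat.pos_of_ne_zero h2) h1) (by omega)
  -- Faltings: `T_p F = 0`, as `Hom_ℚ(E, A) = 0`
  have hTF : ∀ (a : Literature.NumberTheory.EllipticCurves.TateModule E.geomPoints p) (n : ℕ),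
      F (Literature.NumberTheory.EllipticCurves.TateModule.proj p n a) = 0 := by
    intro a n
    let T : AbelianVariety.tateHom E A p :=
      (Literature.NumberTheory.EllipticCurves.TateModule.map p
          F).intertwiningMap_of_isIntertwiningMap
        (E.tateRep p) (A.tateRep p) (fun σ x ↦ by
          refine Literature.NumberTheory.EllipticCurves.TateModule.ext fun n ↦ ?_
          rw [AbelianVariety.tateRep_apply_apply, AbelianVariety.tateRep_apply_apply,
            Literature.NumberTheory.EllipticCurves.TateModule.proj_map,
            Literature.NumberTheory.EllipticCurves.TateModule.proj_smul_of_distribMulAction,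
            Literature.NumberTheory.EllipticCurves.TateModule.proj_smul_of_distribMulAction,
            Literature.NumberTheory.EllipticCurves.TateModule.proj_map, hFσ])
    have hall : ∀ t : TensorProduct ℤ ℤ_[p] (E ⟶ A), t = 0 := fun t ↦ by
      induction t using TensorProduct.induction_on with
      | zero => rfl
      | tmul c g => rw [hfree g, TensorProduct.tmul_zero]
      | add x y hx hy => rw [hx, hy, add_zero]
    have hT0 : T = 0 := by
      obtain ⟨t, ht⟩ := (hFal E A p).2 T
      rw [← ht, hall t, map_zero]
    have h : Literature.NumberTheory.EllipticCurves.TateModule.proj p n (T a) =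
        Literature.NumberTheory.EllipticCurves.TateModule.proj p n
          ((0 : AbelianVariety.tateHom E A p) a) := by rw [hT0]
    rw [Representation.IntertwiningMap.coe_zero, Pi.zero_apply, map_zero] at h
    rw [← h]
    change F _ = Literature.NumberTheory.EllipticCurves.TateModule.proj p n
      (Literature.NumberTheory.EllipticCurves.TateModule.map p F a)
    rw [Literature.NumberTheory.EllipticCurves.TateModule.proj_map]
  -- `[p]` is onto `E(ℚ̄)`, so `F` kills `E[pⁿ]`
  have hpsurj : Function.Surjective fun P : E.geomPoints ↦ p • P := by
    intro y
    have hisog : AbelianVariety.IsIsogeny (((p : ℕ) : ℤ) • 𝟙 E) :=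
      AbelianVariety.isIsogeny_zsmul_id_of_cast_ne_zero (A := E) _ (by exact_mod_cast hp.ne_zero)
    obtain ⟨P₀, hP₀⟩ := hisog.geomPointsMap_surjective y
    refine ⟨P₀, ?_⟩
    change p • P₀ = y
    rw [← hP₀, natCast_zsmul, AbelianVariety.geomPointsMap_nsmul_apply,
      AbelianVariety.Hom.geomPointsMap_id, AddMonoidHom.id_apply]
  have hFtors : ∀ (n : ℕ) (y : E.geomPoints), (p ^ n) • y = 0 → F y = 0 := by
    intro n y hy
    obtain ⟨a, ha⟩ :=
        Literature.NumberTheory.EllipticCurves.TateModule.exists_proj_eq_of_smul_surjective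
      hpsurj n (x := y) (by
        rw [AddSubgroup.torsionBy.nsmul_iff]; exact hy)
    rw [← ha, hTF]
  -- hence `ev f` kills `E[pⁿ]` (`ψE² = D'` is invertible on it)
  have hevtors : ∀ (n : ℕ) (y : E.geomPoints), (p ^ n) • y = 0 → ev f y = 0 := by
    intro n y hy
    have hcop : IsCoprime (D' : ℤ) ((p : ℤ) ^ n) := by
      have hprime : Prime (p : ℤ) := Nat.prime_iff_prime_int.1 hp
      exact ((Prime.coprime_iff_not_dvd hprime).2 hpD').symm.pow_right
    obtain ⟨u, v, huv⟩ := hcop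
    have hy' : y = ψE (ψE (u • y)) := by
      rw [hψψ, smul_smul]
      have : ((p : ℤ) ^ n) • y = 0 := by
        rw [← natCast_zsmul] at hy
        exact_mod_cast hy
      calc y = (u * D' + v * (p : ℤ) ^ n) • y := by rw [huv, one_smul]
        _ = (D' * u) • y := by rw [add_smul, mul_smul v, this, smul_zero, add_zero, mul_comm]
    rw [hy', ← hF]
    apply hFtors n
    rw [← map_nsmul, smul_comm, hy, smul_zero, map_zero]
  -- a projection `π : A_ℚ̄ → E_ℚ̄` with `f ≫ π ≠ 0` (isotypy and torsion-freeness)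
  haveI : Normal ℚ (AlgebraicClosure ℚ) := normal_algebraicClosure_rat
  have hE1' : (E.baseChange (AlgebraicClosure ℚ)).dim = 1 := by
    rw [AbelianVariety.dim_baseChange, hE1]
  obtain ⟨N, hN, hmem⟩ := nsmul_id_mem_closure (E.baseChange (AlgebraicClosure ℚ))
    (A.baseChange (AlgebraicClosure ℚ)) hE1' hiso
  obtain ⟨π, hπ⟩ : ∃ π : A.baseChange (AlgebraicClosure ℚ) ⟶ E.baseChange (AlgebraicClosure ℚ),
      f ≫ π ≠ 0 := by
    by_contra hcon
    push Not at hcon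
    have hzero : ∀ x ∈ AddSubgroup.closure
        {x : A.baseChange (AlgebraicClosure ℚ) ⟶ A.baseChange (AlgebraicClosure ℚ) |
          ∃ (π : A.baseChange (AlgebraicClosure ℚ) ⟶ E.baseChange (AlgebraicClosure ℚ))
            (ι : E.baseChange (AlgebraicClosure ℚ) ⟶ A.baseChange (AlgebraicClosure ℚ)), x = π ≫ ι},
        f ≫ x = 0 := by
      intro x hx
      refine AddSubgroup.closure_induction (p := fun x _ ↦ f ≫ x = 0) ?_ ?_ ?_ ?_ hx
      · rintro x ⟨π, ι, rfl⟩
        rw [← Category.assoc, hcon π, Limits.zero_comp]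
      · exact Limits.comp_zero
      · intro x y _ _ hx hy
        rw [Preadditive.comp_add, hx, hy, add_zero]
      · intro x _ hx
        rw [Preadditive.comp_neg, hx, neg_zero]
    have h1 : N • f = 0 := by
      rw [← Category.comp_id f, ← Preadditive.comp_nsmul]
      exact hzero _ hmem
    haveI := AbelianVariety.isAddTorsionFree_hom_of_charZero (A := E.baseChange (AlgebraicClosure
        ℚ))
      (B := A.baseChange (AlgebraicClosure ℚ))
    exact hf0 ((nsmul_eq_zero_iff_right hN.ne').1 h1)
  -- `g = f ≫ π` is an isogeny of `E_ℚ̄`, with quasi-inverse `g'`: `g ≫ g' = [n]`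
  set g := f ≫ π with hg_def
  have hg : AbelianVariety.IsIsogeny g :=
    AbelianVariety.isIsogeny_of_isSimple_of_ne_zero_end
      (AbelianVariety.isSimple_of_dim_le_one hE1'.le) g hπ
  obtain ⟨g', n, hn, hgg', -⟩ := AbelianVariety.IsIsogeny.exists_nsmul_inverse_holds hg
  -- the corner calculus on `(E ⊞ A)(ℚ̄)`: `[n]` kills `E[pᵏ]`
  have hkill : ∀ (k : ℕ) (y : E.geomPoints), (p ^ k) • y = 0 → n • y = 0 := by
    intro k y hy
    have hev0 : ev f y = 0 := hevtors k y hy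
    -- notation
    let P2 := E ⊞ A
    let act : (P2.baseChange (AlgebraicClosure ℚ) ⟶ P2.baseChange (AlgebraicClosure ℚ)) →
        P2.geomPoints →+ P2.geomPoints := fun r ↦
      ((AddMonoidHom.id P2.geomPoints).comp (MonoidHom.toAdditive (P2.pointsEnd (AlgebraicClosure ℚ)
        r))).comp (AddMonoidHom.id P2.geomPoints)
    have act_comp : ∀ r s z, act (r ≫ s) z = act s (act r z) := fun r s z ↦
      BigImage.act_comp P2 r s z
    have act_bc : ∀ (h : P2 ⟶ P2) z, act (AbelianVariety.Hom.baseChange (AlgebraicClosure ℚ) h) z =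
        AbelianVariety.Hom.geomPointsMap h z := fun h z ↦ BigImage.act_baseChange P2 h z
    let fstL := AbelianVariety.Hom.baseChange (AlgebraicClosure ℚ) (biprod.fst : E ⊞ A ⟶ E)
    let sndL := AbelianVariety.Hom.baseChange (AlgebraicClosure ℚ) (biprod.snd : E ⊞ A ⟶ A)
    let inlL := AbelianVariety.Hom.baseChange (AlgebraicClosure ℚ) (biprod.inl : E ⟶ E ⊞ A)
    let inrL := AbelianVariety.Hom.baseChange (AlgebraicClosure ℚ) (biprod.inr : A ⟶ E ⊞ A)
    have h_inr_snd : inrL ≫ sndL = 𝟙 _ := by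
      change AbelianVariety.Hom.baseChange _ _ ≫ AbelianVariety.Hom.baseChange _ _ = _
      rw [← AbelianVariety.Hom.baseChange_comp, biprod.inr_snd, AbelianVariety.Hom.baseChange_id]
    have h_inl_fst : inlL ≫ fstL = 𝟙 _ := by
      change AbelianVariety.Hom.baseChange _ _ ≫ AbelianVariety.Hom.baseChange _ _ = _
      rw [← AbelianVariety.Hom.baseChange_comp, biprod.inl_fst, AbelianVariety.Hom.baseChange_id]
    set X := fstL ≫ f ≫ inrL with hX
    set Y := sndL ≫ π ≫ inlL with hY
    set G := fstL ≫ g ≫ inlL with hG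
    set G' := fstL ≫ g' ≫ inlL with hG'
    -- `ev f y = snd (act X (inl y))`
    have hev' : ev f y = AbelianVariety.Hom.geomPointsMap (biprod.snd : E ⊞ A ⟶ A)
        (act X (AbelianVariety.Hom.geomPointsMap (biprod.inl : E ⟶ E ⊞ A) y)) := rfl
    -- `act X z` lies in the image of `inr`
    have hXinr : ∀ z, act X z = AbelianVariety.Hom.geomPointsMap (biprod.inr : A ⟶ E ⊞ A)
        (AbelianVariety.Hom.geomPointsMap (biprod.snd : E ⊞ A ⟶ A) (act X z)) := fun z ↦ by
      have h1 : X = X ≫ AbelianVariety.Hom.baseChange (AlgebraicClosure ℚ)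
          (biprod.snd ≫ biprod.inr : E ⊞ A ⟶ E ⊞ A) := by
        rw [AbelianVariety.Hom.baseChange_comp, hX]
        simp only [Category.assoc]
        rw [reassoc_of% h_inr_snd]
      conv_lhs => rw [h1]
      rw [act_comp, act_bc, AbelianVariety.Hom.geomPointsMap_comp, AddMonoidHom.comp_apply]
    have hX0 : act X (AbelianVariety.Hom.geomPointsMap (biprod.inl : E ⟶ E ⊞ A) y) = 0 := by
      rw [hXinr, ← hev', hev0, map_zero]
    -- `X ≫ Y = G`, so `act G (inl y) = 0`
    have hXY : X ≫ Y = G := by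
      rw [hX, hY, hG, hg_def]
      simp only [Category.assoc]
      rw [reassoc_of% h_inr_snd]
    have hG0 : act G (AbelianVariety.Hom.geomPointsMap (biprod.inl : E ⟶ E ⊞ A) y) = 0 := by
      rw [← hXY, act_comp, hX0, map_zero]
    -- `G ≫ G' = n • (fst ≫ inl)_L`
    have hGG' : G ≫ G' = AbelianVariety.Hom.baseChange (AlgebraicClosure ℚ)
        (n • (biprod.fst ≫ biprod.inl : E ⊞ A ⟶ E ⊞ A)) := by
      rw [baseChange_nsmul, AbelianVariety.Hom.baseChange_comp, hG, hG']
      simp only [Category.assoc]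
      rw [reassoc_of% h_inl_fst, reassoc_of% hgg', Preadditive.nsmul_comp, Category.id_comp,
        Preadditive.comp_nsmul]
    have h3 : act (G ≫ G') (AbelianVariety.Hom.geomPointsMap (biprod.inl : E ⟶ E ⊞ A) y) = 0 := by
      rw [act_comp, hG0, map_zero]
    rw [hGG', act_bc, AbelianVariety.geomPointsMap_nsmul_apply,
        AbelianVariety.Hom.geomPointsMap_comp,
      AddMonoidHom.comp_apply, ← AddMonoidHom.comp_apply (AbelianVariety.Hom.geomPointsMap
        (biprod.fst : E ⊞ A ⟶ E)), ← AbelianVariety.Hom.geomPointsMap_comp, biprod.inl_fst,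
      AbelianVariety.Hom.geomPointsMap_id, AddMonoidHom.id_apply, ← map_nsmul] at h3
    have h4 := congrArg (AbelianVariety.Hom.geomPointsMap (biprod.fst : E ⊞ A ⟶ E)) h3
    rwa [map_zero, ← AddMonoidHom.comp_apply, ← AbelianVariety.Hom.geomPointsMap_comp,
        biprod.inl_fst,
      AbelianVariety.Hom.geomPointsMap_id, AddMonoidHom.id_apply] at h4
  -- but `#E[pⁿ] = p²ⁿ > n² = #E[n]`
  have hcardT : ∀ m : ℕ, m ≠ 0 → Nat.card (E.geomTorsion m) = m ^ 2 := fun m hm ↦ by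
    have h := E.natCard_geomTorsion (AbelianVariety.natCard_torsionPoints_of_isAlgClosed_holds E _)
        m
      (by exact_mod_cast hm)
    rwa [Int.natAbs_natCast, hE1, mul_one] at h
  have hsub : ∀ y : E.geomPoints, y ∈ E.geomTorsion ((p ^ n : ℕ) : ℤ) → y ∈ E.geomTorsion (n : ℤ)
      := by
    intro y hy
    rw [AbelianVariety.mem_geomTorsion_iff'] at hy ⊢
    rw [natCast_zsmul] at hy ⊢
    exact hkill n y hy
  haveI : Finite (E.geomTorsion (n : ℤ)) := Nat.finite_of_card_ne_zero
    (by rw [hcardT n hn.ne']; exact pow_ne_zero _ hn.ne')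
  have hle : Nat.card (E.geomTorsion ((p ^ n : ℕ) : ℤ)) ≤ Nat.card (E.geomTorsion (n : ℤ)) :=
    Nat.card_le_card_of_injective (fun y ↦ ⟨y.1, hsub y.1 y.2⟩)
      (fun y y' h ↦ Subtype.ext (by have h' := congrArg Subtype.val h; exact h'))
  rw [hcardT _ (pow_ne_zero _ hp.ne_zero), hcardT n hn.ne'] at hle
  have hlt : n < p ^ n := lt_of_lt_of_le n.lt_two_pow_self (Nat.pow_le_pow_left hp.two_le n)
  have : n ^ 2 < (p ^ n) ^ 2 := Nat.pow_lt_pow_left hlt two_ne_zero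
  omega

end Summit.ABC.ABC.Theorems.IsotypicMinkowski

end
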